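import Summits.BirchSwinnertonDyer.BirchSwinnertonDyer.Theorems.ResidualThetaTransportAtTwoResidualSignedLambdaLowerCMAtTwoFourTermOneSided
import Summits.BirchSwinnertonDyer.BirchSwinnertonDyer.Theorems.ResidualThetaTransportAtTwoLambdaLowerBoundOWeierstrass
import HarnessLib

/-!
# The `(ii)`-half of the S3″ discharge in BOTH currencies: Kato-package form (`ii_clauses_of_package`) and the package-free
# composite form B⁻ (`ii_clauses_of_composite`), with the two algebra lemmas they share (torsion transfer, constant isogenies are λ-invisible)

Route `ResidualThetaTransportAtTwo` (RTT), crux RSL_g `ResidualSignedLambdaLowerCMAtTwo` (stmt-BirchSwinnertonDyer-22608), hold KZ_g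
`KatoZetaCMFormAtTwoSupply` (stmt-BirchSwinnertonDyer-24105). Width seat `prover-bsd-wall-tp2-p2x-w2` g21 (`--supports 22608 --as helper`,
closes nothing). THEOREMS ONLY (no definition, no named fact, no instance, no notation, no `sorry`); pure algebra over `Λ = A⟦X⟧` (`A` a
complete DVR, `F = Frac A`) on Kato's pinned `𝐇¹_Γ(T)` (`I : IwasawaH1DataCoeff`), λ-currency `dim_F (F ⊗_A ·)`. Nothing about any curve or
form is asserted; BSD is not proved by any of this; 22608 / 24105 / 26074 stay OPEN / HOLD.

WHY THIS FILE. The glue `katoZetaCMAtTwo_of_facts : <child A> → <child B> → <S3″ body>` of the KZ_g hold-opening (STUB-PLAN `stub_cmLambdaLower`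
rev 26.4 S128 / S130 β / S132 β; pen scope `KZG-HOLD-OPENING-SCOPE-g19.md` §2) takes its `(ii)`-half from kernel-checked SKETCHES under
`Cruxes/ResidualThetaCountLowerPureAtTwo/` (`Sketch_sidea_k2_g16.lean` §1–§3, `Sketch_sidea_k1_g24.lean` §3–§4), which a `Theorems/` file cannot import.
This is their PORT (credit: stub-ideation k2 g16 — `ii_clauses_of_package`, torsion transfer, constant isogeny; stub-ideation k1 g24 — the
package-free composite B⁻ and `ii_clauses_of_compositeB`), statements verbatim up to (a) the namespace and (b) the `Prop`-valued renderings
`CompositeB` / `PenChildB` of k1-g24 being UNFOLDED into hypotheses (no `Prop` definition is introduced here).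

* §1 `isTorsion_quotient_of_smul_le` — `H/Z` torsion and `a • Z ≤ N` (`a ≠ 0`) ⇒ `H/N` torsion.
* §2 `finrank_baseChange_quotient_eq_of_smul_le` — `λ(H/N) = λ(H/Z)` for `N ≤ Z`, `c • Z ≤ N`, `c ∈ A` a unit in `F`
  (`LambdaLowerBoundO.finrank_baseChange_eq_of_surjective_of_smul_ker_eq_zero`).
* §3 `composite_of_package` — the package, its constants and the [BT26] flank wash out: `𝐇¹_Γ/Λz₀` is torsion and `λ(𝐇¹_Γ/Λz₀) ≤ λ(X₀)` (= B⁻);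
  `ii_clauses_of_composite` (Plan A currency, S132 β) — from B⁻, a torsion-free `z₀` and a decoration `D ≠ 0`:
  `F ⊗ 𝐇¹_Γ/Λ(D•z₀)` is finite-dimensional and `λ(𝐇¹_Γ/Λ(D•z₀)) ≤ λ(X₀) + λ(Λ/(D))` — the `(ii_fin) ∧ (ii_D′)` conjuncts of S3″ with `Sel₀^∨ := X₀`;
  `ii_clauses_of_package` (Plan B/C currency) — the same two conjuncts from Kato's package `P`, the one-sided [BT26] flank
  `(C c)·char 𝐇² ≤ (C d)·char(𝐇¹/Z)`, `z₀ ∈ P.Z` generating `P.Z` up to a constant, and the port `λ(P.H2) ≤ λ(X₀)` (= the composition of the two).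

References: [BurungaleTian2026] Thm. 2.6, Rem. 2.5, Rem. 2.7 (p. 5); [Kato2004Asterisque] Thm. 12.4 (1)(2), Thm. 12.5 (2), Thm. 12.6 (pp. 221–222),
§15.15–15.16 (p. 265); [Kobayashi2003] Prop. 7.1 ii) (p. 12); [Washington1997] §13.2.
-/

set_option autoImplicit false
-- the Theorems namespace of this sub repeats the summit name by design (D-0017 nested layout)
set_option linter.dupNamespace false

noncomputable section

open scoped TensorProduct Classical

namespace Summit.BirchSwinnertonDyer.BirchSwinnertonDyer.Theorems.CharIdealLambda.ZetaQuotientComposite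

open Literature.NumberTheory.EllipticCurves Literature.NumberTheory.EllipticCurves.Kato2004
open Literature.NumberTheory.GaloisRepresentations
open Summit.BirchSwinnertonDyer.BirchSwinnertonDyer.Theorems

/-! ## §1 Torsion transfer along a constant isogeny -/

/-- **Torsion transfer**: if `H/Z` is `R`-torsion and a nonzero `a ∈ R` multiplies `Z` into `N`, then `H/N` is `R`-torsion
(`(a·b) • y ∈ N` whenever `b • y ∈ Z`). Port of `Sketch_sidea_k2_g16.lean` §1 (stub-ideation k2 g16). [cite: Washington1997, §13.2] -/
theorem isTorsion_quotient_of_smul_le {R : Type*} [CommRing R] [IsDomain R] {H : Type*} [AddCommGroup H]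
    [Module R H] {N Z : Submodule R H} (a : R) (ha : a ≠ 0) (haZ : ∀ z ∈ Z, a • z ∈ N)
    (hZ : Module.IsTorsion R (H ⧸ Z)) : Module.IsTorsion R (H ⧸ N) := by
  intro x
  induction x using Submodule.Quotient.induction_on with
  | H y =>
    obtain ⟨⟨b, hb⟩, hby⟩ := @hZ (Z.mkQ y)
    rw [Submonoid.mk_smul, Submodule.mkQ_apply, ← Submodule.Quotient.mk_smul,
      Submodule.Quotient.mk_eq_zero] at hby
    refine ⟨⟨a * b, mem_nonZeroDivisors_of_ne_zero (mul_ne_zero ha (nonZeroDivisors.ne_zero hb))⟩, ?_⟩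
    rw [Submonoid.mk_smul, ← Submodule.Quotient.mk_smul, Submodule.Quotient.mk_eq_zero, mul_smul]
    exact haZ _ hby

/-- Decorating a generator keeps the quotient torsion: `H/Λz₀` torsion and `D ≠ 0` ⇒ `H/Λ(D•z₀)` torsion.
[cite: Kato2004Asterisque, Thm. 12.4 (2) (p. 221)] -/
theorem isTorsion_quotient_span_smul {R : Type*} [CommRing R] [IsDomain R] {H : Type*} [AddCommGroup H]
    [Module R H] (z₀ : H) (D : R) (hD : D ≠ 0) (htors : Module.IsTorsion R (H ⧸ Submodule.span R {z₀})) :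
    Module.IsTorsion R (H ⧸ Submodule.span R {D • z₀}) := by
  refine isTorsion_quotient_of_smul_le D hD (fun z hz => ?_) htors
  rw [Submodule.mem_span_singleton] at hz
  obtain ⟨b, rfl⟩ := hz
  rw [smul_smul, mul_comm, ← smul_smul]
  exact Submodule.smul_mem _ _ (Submodule.mem_span_singleton_self _)

/-! ## §2 A constant isogeny is λ-invisible -/

/-- **`λ(H/N) = λ(H/Z)`** for `N ≤ Z` with `c • Z ≤ N` and `c ∈ A` invertible in `F`: the surjection `H/N ↠ H/Z` has kernel killed by `c`, so it
becomes an isomorphism after `F ⊗_A ·` (`LambdaLowerBoundO.finrank_baseChange_eq_of_surjective_of_smul_ker_eq_zero`). Port of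
`Sketch_sidea_k2_g16.lean` §2 (stub-ideation k2 g16). [cite: Washington1997, §13.2] -/
theorem finrank_baseChange_quotient_eq_of_smul_le {A : Type*} [CommRing A] (F : Type*) [Field F] [Algebra A F]
    {Λ : Type*} [CommRing Λ] [Algebra A Λ] {H : Type*} [AddCommGroup H] [Module Λ H] [Module A H]
    [IsScalarTower A Λ H] {N Z : Submodule Λ H} (hle : N ≤ Z) (c : A) (hc : IsUnit (algebraMap A F c))
    (hcZ : ∀ z ∈ Z, c • z ∈ N) :
    Module.finrank F (F ⊗[A] (H ⧸ N)) = Module.finrank F (F ⊗[A] (H ⧸ Z)) := by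
  refine LambdaLowerBoundO.finrank_baseChange_eq_of_surjective_of_smul_ker_eq_zero F
    ((Submodule.factor hle).restrictScalars A) (Submodule.factor_surjective hle) c hc ?_
  intro x hx
  obtain ⟨h, rfl⟩ := Submodule.Quotient.mk_surjective N x
  rw [LinearMap.mem_ker, LinearMap.restrictScalars_apply] at hx
  change Submodule.factor hle (N.mkQ h) = 0 at hx
  rw [Submodule.factor_mk, Submodule.mkQ_apply, Submodule.Quotient.mk_eq_zero] at hx
  rw [← Submodule.Quotient.mk_smul, Submodule.Quotient.mk_eq_zero]
  exact hcZ h hx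

/-! ## §3–§4 The `(ii)`-clauses of S3″ on Kato's `𝐇¹_Γ(T)`: package currency and package-free composite currency -/

section Kato

variable {A : Type} [CommRing A] [TopologicalSpace A] [IsDomain A] [IsDiscreteValuationRing A]
    [IsAdicComplete (IsLocalRing.maximalIdeal A) A] {V : Type} [AddCommGroup V] [Module A V] [TopologicalSpace V]
    [IsTopologicalAddGroup V] [ContinuousSMul A V] {T : GaloisRep ℚ A V} {p : ℕ} [Fact p.Prime]
    {κ : ZpExtension ℚ p} {γ : Field.absoluteGaloisGroup ℚ} {I : IwasawaH1DataCoeff T p κ γ}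
    [Module A I.H] [IsScalarTower A (PowerSeries A) I.H]
    (F : Type) [Field F] [Algebra A F] [IsFractionRing A F]

/-- **B → B⁻: the package, its constants and the [BT26] flank wash out.** From ANY Kato package `P` with `z₀ ∈ P.Z` generating `P.Z` up to a
constant `c₀ ≠ 0`, the one-sided flank `(C c)·char 𝐇² ≤ (C d)·char(𝐇¹/Z)` and the port `λ(P.H2) ≤ λ(X₀)`: `𝐇¹_Γ/Λz₀` is `Λ`-torsion
(`c₀`-transfer from `P.isTorsion_quotient`) and `λ(𝐇¹_Γ/Λz₀) = λ(𝐇¹_Γ/P.Z) ≤ λ(P.H2) ≤ λ(X₀)`. Port of `Sketch_sidea_k1_g24.lean` §3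
`compositeB_of_penChildB` (stub-ideation k1 g24), with the renderings `PenChildB` / `CompositeB` unfolded.
[cite: BurungaleTian2026, Thm. 2.6 and Rem. 2.5 (p. 5)] [cite: Kato2004Asterisque, Thm. 12.4 (2), Thm. 12.5 (2), Thm. 12.6 (pp. 221–222)] -/
theorem composite_of_package (hI : Module.Finite (PowerSeries A) I.H)
    (P : ZetaQuotientPackage I) [Module A P.H2] [IsScalarTower A (PowerSeries A) P.H2]
    (hP : ∃ c d : A, c ≠ 0 ∧ d ≠ 0 ∧
      Ideal.span {PowerSeries.C c} * P.charH2 ≤ Ideal.span {PowerSeries.C d} * P.charZetaQuotient)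
    (z₀ : I.H) (hz₀ : z₀ ∈ P.Z) (c₀ : A) (hc₀ : c₀ ≠ 0) (hgen : ∀ z ∈ P.Z, c₀ • z ∈ Submodule.span (PowerSeries A) {z₀})
    {X₀ : Type} [AddCommGroup X₀] [Module A X₀]
    (hPT : Module.finrank F (F ⊗[A] P.H2) ≤ Module.finrank F (F ⊗[A] X₀)) :
    Module.IsTorsion (PowerSeries A) (I.H ⧸ Submodule.span (PowerSeries A) {z₀}) ∧
      Module.finrank F (F ⊗[A] (I.H ⧸ Submodule.span (PowerSeries A) {z₀})) ≤ Module.finrank F (F ⊗[A] X₀) := by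
  haveI := hI
  set Λz := Submodule.span (PowerSeries A) {z₀} with hΛz
  have hleZ : Λz ≤ P.Z := by
    rw [hΛz, Submodule.span_singleton_le_iff_mem]; exact hz₀
  have hCc₀ : (PowerSeries.C c₀ : PowerSeries A) ≠ 0 := fun h =>
    hc₀ (PowerSeries.C_injective (by rw [h, map_zero]))
  have hgenΛ : ∀ z ∈ P.Z, (PowerSeries.C c₀ : PowerSeries A) • z ∈ Λz := fun z hz => by
    rw [PowerSeries.C_eq_algebraMap, algebraMap_smul]; exact hgen z hz
  have htors : Module.IsTorsion (PowerSeries A) (I.H ⧸ Λz) :=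
    isTorsion_quotient_of_smul_le (PowerSeries.C c₀) hCc₀ hgenΛ P.isTorsion_quotient
  refine ⟨htors, ?_⟩
  have hunit : IsUnit (algebraMap A F c₀) := by
    refine isUnit_iff_ne_zero.mpr fun h => hc₀ (IsFractionRing.injective A F ?_)
    rw [h, map_zero]
  have h1 : Module.finrank F (F ⊗[A] (I.H ⧸ Λz)) = Module.finrank F (F ⊗[A] (I.H ⧸ P.Z)) :=
    finrank_baseChange_quotient_eq_of_smul_le F hleZ c₀ hunit hgen
  have h2 := CharIdealLambda.finrank_baseChange_zetaQuotient_le_H2_of_span_C_mul_charIdeal_le hI P hP F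
  calc Module.finrank F (F ⊗[A] (I.H ⧸ Λz))
      = Module.finrank F (F ⊗[A] (I.H ⧸ P.Z)) := h1
    _ ≤ Module.finrank F (F ⊗[A] P.H2) := h2
    _ ≤ Module.finrank F (F ⊗[A] X₀) := hPT

/-- **`(ii)`-clauses from the package-free composite B⁻ (Plan A currency, S132 β).** If `𝐇¹_Γ/Λz₀` is `Λ`-torsion and
`λ(𝐇¹_Γ/Λz₀) ≤ λ(X₀)` (the composite print∘port clause: [BT26] Thm 2.6 ⊗ℚ ∘ Kato 12.5 (1)/12.6 ∘ Kurihara–Kobayashi Prop 7.1 ii)), then for every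
torsion-free `z₀` and decoration `D ≠ 0`: `F ⊗ 𝐇¹_Γ/Λ(D•z₀)` is finite-dimensional and `λ(𝐇¹_Γ/Λ(D•z₀)) ≤ λ(X₀) + λ(Λ/(D))` — the `(ii_fin) ∧ (ii_D′)`
conjuncts of S3″ for `z := D • z₀`. Port of `Sketch_sidea_k1_g24.lean` §4 `ii_clauses_of_compositeB` (stub-ideation k1 g24), with `CompositeB` unfolded
into the two hypotheses `htors`, `hle`. [cite: BurungaleTian2026, Thm. 2.6 (p. 5)] [cite: Kato2004Asterisque, Thm. 12.4 (2), Thm. 12.5 (2) (pp. 221–222)]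
[cite: Kobayashi2003, Prop. 7.1 ii) (p. 12)] -/
theorem ii_clauses_of_composite (hI : Module.Finite (PowerSeries A) I.H) (z₀ : I.H)
    (hz₀tf : ∀ a : PowerSeries A, a • z₀ = 0 → a = 0) (D : PowerSeries A) (hD : D ≠ 0)
    {X₀ : Type} [AddCommGroup X₀] [Module A X₀]
    (htors : Module.IsTorsion (PowerSeries A) (I.H ⧸ Submodule.span (PowerSeries A) {z₀}))
    (hle : Module.finrank F (F ⊗[A] (I.H ⧸ Submodule.span (PowerSeries A) {z₀})) ≤ Module.finrank F (F ⊗[A] X₀)) :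
    Module.Finite F (F ⊗[A] (I.H ⧸ Submodule.span (PowerSeries A) {D • z₀})) ∧
      Module.finrank F (F ⊗[A] (I.H ⧸ Submodule.span (PowerSeries A) {D • z₀})) ≤
        Module.finrank F (F ⊗[A] X₀) + Module.finrank F (F ⊗[A] (PowerSeries A ⧸ Ideal.span {D})) := by
  haveI := hI
  have htorsD : Module.IsTorsion (PowerSeries A) (I.H ⧸ Submodule.span (PowerSeries A) {D • z₀}) :=
    isTorsion_quotient_span_smul z₀ D hD htors
  have hfin : Module.Finite F (F ⊗[A] (I.H ⧸ Submodule.span (PowerSeries A) {D • z₀})) :=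
    CharIdealLambda.finite_baseChange_of_isTorsion F _ htorsD
  have h2 := CharIdealLambda.finrank_baseChange_quotient_span_smul_eq_add F z₀ hz₀tf D hD htors
  exact ⟨hfin, by omega⟩

/-- **`(ii)`-clauses from Kato's package (Plan B/C currency).** For a package `P` on `𝐇¹_Γ(T)` (`A` a complete DVR, `F = Frac A`, `𝐇¹_Γ` finitely
generated), the one-sided char-ideal relation `(C c)·char 𝐇² ≤ (C d)·char(𝐇¹_Γ/Z)` ([BT26] Thm 2.6 ⊗ℚ, the half RSL_g consumes), an element
`z₀ ∈ Z` without `Λ`-torsion generating `Z` up to the constant `c₀ ≠ 0`, a decoration `D ≠ 0`, and the port `λ(𝐇²) ≤ λ(X₀)`: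
`F ⊗ 𝐇¹_Γ/Λ(D•z₀)` is finite-dimensional and `λ(𝐇¹_Γ/Λ(D•z₀)) ≤ λ(X₀) + λ(Λ/(D))` — literally the `(ii_fin) ∧ (ii_D′)` conjuncts of S3″ with
`Sel₀^∨ := X₀`. Same statement as `Sketch_sidea_k2_g16.lean` §3 `ii_clauses_of_package` (stub-ideation k2 g16); proved here as
`ii_clauses_of_composite ∘ composite_of_package` (the two currencies agree on what the glue consumes).
[cite: BurungaleTian2026, Thm. 2.6 (p. 5)] [cite: Kato2004Asterisque, Thm. 12.4 (1)(2), Thm. 12.5 (2), Thm. 12.6 (pp. 221–222)]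
[cite: Kobayashi2003, Prop. 7.1 ii) (p. 12)] -/
theorem ii_clauses_of_package (hI : Module.Finite (PowerSeries A) I.H)
    (P : ZetaQuotientPackage I) [Module A P.H2] [IsScalarTower A (PowerSeries A) P.H2]
    (hP : ∃ c d : A, c ≠ 0 ∧ d ≠ 0 ∧
      Ideal.span {PowerSeries.C c} * P.charH2 ≤ Ideal.span {PowerSeries.C d} * P.charZetaQuotient)
    (z₀ : I.H) (hz₀ : z₀ ∈ P.Z) (hz₀tf : ∀ a : PowerSeries A, a • z₀ = 0 → a = 0)
    (c₀ : A) (hc₀ : c₀ ≠ 0) (hgen : ∀ z ∈ P.Z, c₀ • z ∈ Submodule.span (PowerSeries A) {z₀})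
    (D : PowerSeries A) (hD : D ≠ 0)
    {X₀ : Type} [AddCommGroup X₀] [Module A X₀]
    (hPT : Module.finrank F (F ⊗[A] P.H2) ≤ Module.finrank F (F ⊗[A] X₀)) :
    Module.Finite F (F ⊗[A] (I.H ⧸ Submodule.span (PowerSeries A) {D • z₀})) ∧
      Module.finrank F (F ⊗[A] (I.H ⧸ Submodule.span (PowerSeries A) {D • z₀})) ≤
        Module.finrank F (F ⊗[A] X₀) + Module.finrank F (F ⊗[A] (PowerSeries A ⧸ Ideal.span {D})) :=
  have hB := composite_of_package F hI P hP z₀ hz₀ c₀ hc₀ hgen hPT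
  ii_clauses_of_composite F hI z₀ hz₀tf D hD hB.1 hB.2

end Kato

end Summit.BirchSwinnertonDyer.BirchSwinnertonDyer.Theorems.CharIdealLambda.ZetaQuotientComposite

end
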